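import Literature.Topology.FourManifolds.ConnectedSumNormalForm
import Literature.Topology.FourManifolds.KnotsProofs
import Literature.Topology.FourManifolds.KnotsIsotopyProofs
import HarnessLib

/-!
# Mirror image and reversal are compatible with isotopy

Sibling proof file of `Knots.lean` (topic `Literature/Topology/FourManifolds`). The oriented knot
type (`SphereEmbedding.IsIsotopic`, ambient isotopy in `𝕊 n`) is preserved by the two symmetries
of `Knots.lean`, the **mirror image** `K.mirror = reflectLast n ∘ K` and the **reverse**
`K.reverse = K ∘ reflectLast k` (Rolfsen, *Knots and Links* (1976), §3.C: the obverse and the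
reverse of a knot *type* are well defined; §1.A: equivalent knots have equivalent images under
a homeomorphism of the ambient sphere):

* `SphereEmbedding.IsIsotopic.reverse` — `K ≅ K' → K.reverse ≅ K'.reverse` (the *same* ambient
  isotopy: `F 1 ∘ (K ∘ r) = (F 1 ∘ K) ∘ r`);
* `SphereEmbedding.IsIsotopic.mirror` — `K ≅ K' → K.mirror ≅ K'.mirror` (the ambient isotopy
  *conjugated* by the reflection `R = reflectLastDiffeo n` of `KnotsProofs.lean`,
  `AmbientIsotopy.conj` / `SphereEmbedding.IsIsotopic.map_congr` of `ConnectedSumNormalForm.lean`: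
  `R F_t R⁻¹` carries `R ∘ K` to `R ∘ K'`);
* `SphereEmbedding.IsIsotopic.mirror_reverse` — hence `K ≅ K' → -K̄ ≅ -K̄'` for the reversed
  mirror image `-K̄ = K.mirror.reverse`, the representative of the inverse in the concordance
  group (Fox–Milnor (1966), §3; used by the symmetric-union witness of
  `Knot.isSmoothlySlice_of_isConnectedSum_mirror_reverse`, `BandSumFoxMilnor.lean`);
* the `iff` forms `SphereEmbedding.isIsotopic_mirror_iff`, `isIsotopic_reverse_iff`,
  `isIsotopic_mirror_reverse_iff` (both operations are involutions), and the exchange laws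
  `SphereEmbedding.isIsotopic_mirror_comm`, `isIsotopic_reverse_comm`
  (`K ≅ K'.mirror ↔ K.mirror ≅ K'`), using symmetry of isotopy
  (`SphereEmbedding.IsIsotopic.symm_holds`, `KnotsIsotopyProofs.lean`);
* for knots: amphichirality, negative amphichirality and invertibility
  (`Knot.IsAmphichiral`, `Knot.IsNegativeAmphichiral`, `Knot.IsInvertible`, `Knots.lean`) are
  properties of the knot type (`Knot.IsAmphichiral.of_isIsotopic`, …).

## References

* D. Rolfsen, *Knots and Links*, Publish or Perish (1976), §1.A, §3.C. [Rolfsen1976]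
* R. H. Fox, J. W. Milnor, *Singularities of 2-spheres in 4-space and cobordism of knots*, Osaka
  J. Math. 3 (1966), 257–267, §3 (`-κ`: "reversing the orientation of both the knot `k` and the
  containing 3-sphere"). [FoxMilnor1966]

## Design notes

No statement of another file is modified; no definitions, no notation, no named facts, no
`sorry`. The `[SphereEmbedding.SmoothnessFacts]` argument of `mirror`/`reverse` is the instance
`SphereEmbedding.smoothnessFacts` of `KnotsProofs.lean`.
-/

open scoped Manifold ContDiff Topology
open Function Set Metric

noncomputable section

namespace Literature.Topology.FourManifolds

namespace SphereEmbedding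

variable {k n : ℕ}

/-! ## Reversal -/

/-- **Isotopic sphere embeddings have isotopic reverses** (the same ambient isotopy).
Rolfsen (1976), §3.C. [cite: Rolfsen1976, §3.C] -/
theorem IsIsotopic.reverse {K K' : SphereEmbedding k n} (h : K.IsIsotopic K') :
    K.reverse.IsIsotopic K'.reverse := by
  obtain ⟨F, hF⟩ := h
  refine ⟨F, ?_⟩
  rw [coe_reverse, coe_reverse, ← comp_assoc, hF]

/-- `K.reverse ≅ K'.reverse ↔ K ≅ K'` (reversal is an involution). [cite: Rolfsen1976, §3.C] -/
theorem isIsotopic_reverse_iff {K K' : SphereEmbedding k n} :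
    K.reverse.IsIsotopic K'.reverse ↔ K.IsIsotopic K' :=
  ⟨fun h ↦ by simpa only [reverse_reverse] using h.reverse, IsIsotopic.reverse⟩

/-- Exchange law `K ≅ K'.reverse ↔ K.reverse ≅ K'`. [cite: Rolfsen1976, §3.C] -/
theorem isIsotopic_reverse_comm {K K' : SphereEmbedding k n} :
    K.IsIsotopic K'.reverse ↔ K.reverse.IsIsotopic K' := by
  rw [← isIsotopic_reverse_iff (K := K), reverse_reverse]

/-! ## Mirror image -/

/-- The mirror image is the image under the reflection diffeomorphism `reflectLastDiffeo n`
(`KnotsProofs.lean`), as a bundled embedding (`SphereEmbedding.map`,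
`GluckTwistTransport.lean`). [folklore] -/
theorem map_reflectLastDiffeo (K : SphereEmbedding k n) : K.map (reflectLastDiffeo n) = K.mirror :=
  SphereEmbedding.ext rfl

/-- **Isotopic sphere embeddings have isotopic mirror images**: conjugate the ambient isotopy
by the reflection of `𝕊 n` in its last coordinate (`SphereEmbedding.IsIsotopic.map_congr`).
Rolfsen (1976), §1.A, §3.C. [cite: Rolfsen1976, §3.C] -/
theorem IsIsotopic.mirror {K K' : SphereEmbedding k n} (h : K.IsIsotopic K') :
    K.mirror.IsIsotopic K'.mirror := by
  rw [← map_reflectLastDiffeo, ← map_reflectLastDiffeo]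
  exact h.map_congr (reflectLastDiffeo n)

/-- `K.mirror ≅ K'.mirror ↔ K ≅ K'` (the mirror image is an involution).
[cite: Rolfsen1976, §3.C] -/
theorem isIsotopic_mirror_iff {K K' : SphereEmbedding k n} :
    K.mirror.IsIsotopic K'.mirror ↔ K.IsIsotopic K' :=
  ⟨fun h ↦ by simpa only [mirror_mirror] using h.mirror, IsIsotopic.mirror⟩

/-- Exchange law `K ≅ K'.mirror ↔ K.mirror ≅ K'`. [cite: Rolfsen1976, §3.C] -/
theorem isIsotopic_mirror_comm {K K' : SphereEmbedding k n} :
    K.IsIsotopic K'.mirror ↔ K.mirror.IsIsotopic K' := by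
  rw [← isIsotopic_mirror_iff (K := K), mirror_mirror]

/-! ## The reversed mirror image `-K̄` -/

/-- **Isotopic sphere embeddings have isotopic reversed mirror images** `-K̄ = K.mirror.reverse`
(Fox–Milnor's `-κ`, the inverse in the knot concordance group). Fox–Milnor (1966), §3;
Rolfsen (1976), §3.C. [cite: FoxMilnor1966, §3] -/
theorem IsIsotopic.mirror_reverse {K K' : SphereEmbedding k n} (h : K.IsIsotopic K') :
    K.mirror.reverse.IsIsotopic K'.mirror.reverse :=
  h.mirror.reverse

/-- `-K̄ ≅ -K̄' ↔ K ≅ K'`. [cite: FoxMilnor1966, §3] -/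
theorem isIsotopic_mirror_reverse_iff {K K' : SphereEmbedding k n} :
    K.mirror.reverse.IsIsotopic K'.mirror.reverse ↔ K.IsIsotopic K' := by
  rw [isIsotopic_reverse_iff, isIsotopic_mirror_iff]

/-- `-(-K̄)‾ = K`: the reversed mirror image is an involution. [folklore] -/
@[simp]
theorem mirror_reverse_mirror_reverse (K : SphereEmbedding k n) :
    K.mirror.reverse.mirror.reverse = K := by
  rw [mirror_reverse K.mirror, mirror_mirror, reverse_reverse]

/-- Exchange law `K ≅ -K̄' ↔ -K̄ ≅ K'`. [cite: FoxMilnor1966, §3] -/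
theorem isIsotopic_mirror_reverse_comm {K K' : SphereEmbedding k n} :
    K.IsIsotopic K'.mirror.reverse ↔ K.mirror.reverse.IsIsotopic K' := by
  rw [← isIsotopic_mirror_reverse_iff (K := K), mirror_reverse_mirror_reverse]

end SphereEmbedding

/-! ## Symmetry properties of knots are properties of the knot type -/

namespace Knot

/-- **Amphichirality is a property of the knot type**: if `K ≅ K'` and `K ≅ K.mirror` then
`K' ≅ K'.mirror` (`K' ≅ K ≅ K.mirror ≅ K'.mirror`). Rolfsen (1976), §3.C.
[cite: Rolfsen1976, §3.C] -/
theorem IsAmphichiral.of_isIsotopic {K K' : Knot} (h : K.IsIsotopic K') (hK : K.IsAmphichiral) :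
    K'.IsAmphichiral :=
  SphereEmbedding.IsIsotopic.trans_holds (SphereEmbedding.IsIsotopic.symm_holds h)
    (SphereEmbedding.IsIsotopic.trans_holds hK h.mirror)

/-- **Negative amphichirality is a property of the knot type.** Rolfsen (1976), §3.C.
[cite: Rolfsen1976, §3.C] -/
theorem IsNegativeAmphichiral.of_isIsotopic {K K' : Knot} (h : K.IsIsotopic K')
    (hK : K.IsNegativeAmphichiral) : K'.IsNegativeAmphichiral :=
  SphereEmbedding.IsIsotopic.trans_holds (SphereEmbedding.IsIsotopic.symm_holds h)
    (SphereEmbedding.IsIsotopic.trans_holds hK h.mirror_reverse)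

/-- **Invertibility is a property of the knot type.** Rolfsen (1976), §3.C.
[cite: Rolfsen1976, §3.C] -/
theorem IsInvertible.of_isIsotopic {K K' : Knot} (h : K.IsIsotopic K') (hK : K.IsInvertible) :
    K'.IsInvertible :=
  SphereEmbedding.IsIsotopic.trans_holds (SphereEmbedding.IsIsotopic.symm_holds h)
    (SphereEmbedding.IsIsotopic.trans_holds hK h.reverse)

end Knot

end Literature.Topology.FourManifolds
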